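import Summits.ResolutionOfSingularities.ResolutionOfSingularities.Theorems.EquisingularLiftEquisingularLiftNatTowerRoundTwoDefs
import Summits.ResolutionOfSingularities.ResolutionOfSingularities.Theorems.EquisingularLiftEquisingularLiftNatLiftableNoseClass2ThenPoints
import Summits.ResolutionOfSingularities.ResolutionOfSingularities.Theorems.EquisingularLiftEquisingularLiftNatNoseThenPointsOfLiftableCentre
import Summits.ResolutionOfSingularities.ResolutionOfSingularities.Theses.EquisingularLift
import HarnessLib

/-!
# Route `EquisingularLift`, crux EL♮(3) (stmt-ResolutionOfSingularities-20148) / EL♮ (stmt-…-20038) — rung NOSE-TOWER ₃: the registered stub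
# `stub_elnat_ratNoseTowerResolution` MODULO THE NOSE-TOWER ENGINE (the tower twin of res-type-051's `horizBody_of_noseThenPoints`)

res-L1-w45b-lead-2 g2 (lead, text owner), answering res-L1-w45b-plan-1 19:55:25Z (a). OURS; pure-logic composition; AI-written. The NOSE rung is NOT a
one-line K5′ instance (K5′ hangs its `Reach` chains off a point step; the nose chain starts with the curve blow-up at the base). Its closer is the
composition «Witt ring (`stub_wittRing`) → lift of the class-₂ nose (`lift_of_isLiftableNoseClass₂`, p538681) → per (φ, Y) the NOSE-TOWER ENGINE»,
exactly as `elnat_noseThenPoints_of_liftableCentre` (res-L1-w45b-lead-2 g1) composes `horizBody_of_noseThenPoints` (res-type-051, p516996).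
This file FIXES THE ENGINE'S INTERFACE and proves the composition: the hypothesis `hEngine` is the statement of `horizBody_of_noseThenPoints` with
its point-only downstairs continuation `hdown` REPLACED by `ReachNoseTower₃`'s inner clause (seed `(F₂, 𝟙, St ι(H), υ⁻¹Z, ∅)`, constructors
`TowerPtReg₂` / `TowerPtRam₂` / `TowerRound₂` at carrier stage `ℙⁿ_k` and carrier blow-up `υ`, …NatTowerRoundTwoDefs p562650), plus the three
downstairs certificates the registered text carries (`IsClosed Z` as `hZc`, `Z.Infinite`, `Z̃ ≅ ℙ¹_k`), `Z` being spelled `(C.comap (Proj.map φ hφ')).support`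
as in the engine. Whoever proves `hEngine` (res-type-051 on wake / res-D-pv-035 after its driver / the successor lead) may take res-D-pv-035's
HSUB′(ReachNoseTower₃) (`HSUB-RATNOSETOWER3.sig.txt` cad6759341cbb034) as hypothesis; the END transport is `horizBody_of_noseThenPoints`'s, verbatim.
* `stub_elnat_ratNoseTowerResolution_of_noseTowerEngine` — ENGINE′ ⇒ the registered stub (text `TARGET-RATNOSETOWER3.sig.txt` 3a52d702128a1d15).
-/

set_option linter.dupNamespace false
set_option linter.overlappingInstances false

noncomputable section

open CategoryTheory CategoryTheory.Limits AlgebraicGeometry TopologicalSpace Topology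
open MvPolynomial
open Literature.AlgebraicGeometry.Resolution
open AlgebraicGeometry.Scheme.IdealSheafData
open Summit.ResolutionOfSingularities.ResolutionOfSingularities.Theses.EquisingularLift.Split
open Summit.ResolutionOfSingularities.ResolutionOfSingularities.Cruxes.EquisingularLift.StrataSplit


namespace Summit.ResolutionOfSingularities.ResolutionOfSingularities.Cruxes.EquisingularLiftNat.Sections

/-- **NOSE-TOWER₃ closer modulo the engine**: the tower twin ENGINE′ of `horizBody_of_noseThenPoints` (hypothesis `hEngine`, interface fixed here)
implies the registered stub `stub_elnat_ratNoseTowerResolution` (Reach := `ReachNoseTower₃`). Composition: Witt ring, `lift_of_isLiftableNoseClass₂`,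
transport of the nose data along `C.comap (Proj.map φ) = 𝓘⟨Z⟩`. [OURS · pure logic] -/
theorem stub_elnat_ratNoseTowerResolution_of_noseTowerEngine (p : ℕ)
    (hEngine : ∀ (O : Type) [CommRing O] [IsDomain O] [IsDiscreteValuationRing O]
    [IsAdicComplete (IsLocalRing.maximalIdeal O) O] [IsAlgClosed (IsLocalRing.ResidueField O)]
    (k : Type) [Field k] (π : O →+* k) (hπ : Function.Surjective π) (n : ℕ),
      (letI := MvPolynomial.gradedAlgebra (σ := Fin (n + 1)) (R := O); letI := MvPolynomial.gradedAlgebra (σ := Fin (n + 1)) (R := k);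
      ∀ (H : Scheme.{0})
    (ι : H ⟶ Proj (homogeneousSubmodule (Fin (n + 1)) k)) (hιc : IsClosedImmersion ι) (hHi : IsIntegral H)
    (φ : homogeneousSubmodule (Fin (n + 1)) O →+*ᵍ homogeneousSubmodule (Fin (n + 1)) k)
    (hφ' : HomogeneousIdeal.irrelevant (homogeneousSubmodule (Fin (n + 1)) k) ≤
      (HomogeneousIdeal.irrelevant (homogeneousSubmodule (Fin (n + 1)) O)).map φ)
    (hφ : ∀ s, φ s = MvPolynomial.map π s)
    (C : (Proj (homogeneousSubmodule (Fin (n + 1)) O)).IdealSheafData)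
    (hCsm : Smooth (C.subschemeι ≫ Proj.toSpecZero (homogeneousSubmodule (Fin (n + 1)) O) ≫
      Spec.map (CommRingCat.ofHom (algebraMap O (homogeneousSubmodule (Fin (n + 1)) O 0)))))
    (hgen : ¬ (Set.range ι ⊆ ((C.comap (Proj.map φ hφ')).support : Set (Proj (homogeneousSubmodule (Fin (n + 1)) k)))))
    (hsupp : ((C.comap (Proj.map φ hφ')).support : Set (Proj (homogeneousSubmodule (Fin (n + 1)) k))) ⊆ Set.range ι)
    (hZc : IsClosed ((C.comap (Proj.map φ hφ')).support : Set (Proj (homogeneousSubmodule (Fin (n + 1)) k))))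
    (hinf : ((C.comap (Proj.map φ hφ')).support : Set (Proj (homogeneousSubmodule (Fin (n + 1)) k))).Infinite)
    (hrat : Nonempty (redSub (Proj (homogeneousSubmodule (Fin (n + 1)) k)) ((C.comap (Proj.map φ hφ')).support : Set (Proj (homogeneousSubmodule (Fin (n + 1)) k))) hZc ≅ (Literature.AlgebraicGeometry.Motives.projectiveSpace 1 k).left))
    (hdown : ∃ (F₂ : Scheme.{0}) (υ : F₂ ⟶ Proj (homogeneousSubmodule (Fin (n + 1)) k)),
      IsBlowup υ (C.comap (Proj.map φ hφ')) ∧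
      ∃ (F' : Scheme.{0}) (γ' : F' ⟶ F₂) (T' E' K' : Set F'),
        (∀ R₁ : (∀ G : Scheme.{0}, (G ⟶ F₂) → Set G → Set G → Set G → Prop),
          R₁ F₂ (𝟙 F₂) (closure (υ ⁻¹' (Set.range ι \ ((C.comap (Proj.map φ hφ')).support : Set (Proj (homogeneousSubmodule (Fin (n + 1)) k)))))) (υ ⁻¹' ((C.comap (Proj.map φ hφ')).support : Set (Proj (homogeneousSubmodule (Fin (n + 1)) k)))) ∅ →
          TowerPtReg₂ (Proj (homogeneousSubmodule (Fin (n + 1)) k)) F₂ υ R₁ → TowerPtRam₂ (Proj (homogeneousSubmodule (Fin (n + 1)) k)) F₂ υ R₁ →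
          TowerRound₂ (Proj (homogeneousSubmodule (Fin (n + 1)) k)) F₂ υ ((C.comap (Proj.map φ hφ')).support : Set (Proj (homogeneousSubmodule (Fin (n + 1)) k))) hZc R₁ →
          R₁ F' γ' T' E' K') ∧
        Scheme.IsRegular (redSub F' (closure T') isClosed_closure)),
    ∀ Y : Set (Proj (homogeneousSubmodule (Fin (n + 1)) O)), Y = Set.range (ι ≫ Proj.map φ hφ') →
    ∃ (P' : Scheme.{0}) (σ : P' ⟶ Proj (homogeneousSubmodule (Fin (n + 1)) O)) (S' : Set P'),
      (∀ Q : (∀ X' : Scheme.{0}, (X' ⟶ Proj (homogeneousSubmodule (Fin (n + 1)) O)) → Set X' → Prop),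
        Q (Proj (homogeneousSubmodule (Fin (n + 1)) O)) (𝟙 _) Y →
        (∀ (X' X'' : Scheme.{0}) (σ' : X' ⟶ Proj (homogeneousSubmodule (Fin (n + 1)) O)) (Y' : Set X')
          (C : X'.IdealSheafData) (τ : X'' ⟶ X'), Q X' σ' Y' → IsBlowup τ C → Scheme.IsRegular C.subscheme →
          Flat (C.subschemeι ≫ σ' ≫ (Proj.toSpecZero (homogeneousSubmodule (Fin (n + 1)) O) ≫
            Spec.map (CommRingCat.ofHom (algebraMap O (homogeneousSubmodule (Fin (n + 1)) O 0))))) →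
          σ' '' (C.support : Set X') ⊆ {x | ¬ IsGenericPoint x Y} →
          (C.support : Set X') ∩ (σ' ≫ (Proj.toSpecZero (homogeneousSubmodule (Fin (n + 1)) O) ≫
            Spec.map (CommRingCat.ofHom (algebraMap O (homogeneousSubmodule (Fin (n + 1)) O 0))))) ⁻¹'
            {IsLocalRing.closedPoint O} ⊆ Y' →
          Q X'' (τ ≫ σ') (closure (τ ⁻¹' (Y' \ (C.support : Set X'))))) → Q P' σ S') ∧
      Scheme.IsRegular (vanishingIdeal (⟨closure S', isClosed_closure⟩ : Closeds P')).subscheme)) :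
    p.Prime → ∀ (k : Type) [Field k] [CharP k p] [IsAlgClosed k] (n : ℕ) (H : AlgebraicGeometry.Scheme.{0}) (ι : H ⟶ (Literature.AlgebraicGeometry.Motives.projectiveSpace n k).left), AlgebraicGeometry.IsClosedImmersion ι → AlgebraicGeometry.IsIntegral H → (∀ y : (Literature.AlgebraicGeometry.Motives.projectiveSpace n k).left, ∃ U : (Literature.AlgebraicGeometry.Motives.projectiveSpace n k).left.affineOpens, y ∈ (U : (Literature.AlgebraicGeometry.Motives.projectiveSpace n k).left.Opens) ∧ (ι.ker.ideal U).IsPrincipal) → (ReachNoseTower₃ k n H ι) → ∃ (O : Type) (_ : CommRing O) (_ : IsDomain O) (_ : IsDiscreteValuationRing O) (_ : CharZero O) (π : O →+* k), Function.Surjective π ∧ (letI := MvPolynomial.gradedAlgebra (σ := Fin (n + 1)) (R := O); letI := MvPolynomial.gradedAlgebra (σ := Fin (n + 1)) (R := k); ∀ (φ : MvPolynomial.homogeneousSubmodule (Fin (n + 1)) O →+*ᵍ MvPolynomial.homogeneousSubmodule (Fin (n + 1)) k) (hφ' : HomogeneousIdeal.irrelevant (MvPolynomial.homogeneousSubmodule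 (Fin (n + 1)) k) ≤ (HomogeneousIdeal.irrelevant (MvPolynomial.homogeneousSubmodule (Fin (n + 1)) O)).map φ), (∀ s, φ s = MvPolynomial.map π s) → ∀ Y : Set (AlgebraicGeometry.Proj (MvPolynomial.homogeneousSubmodule (Fin (n + 1)) O)), Y = Set.range (CategoryTheory.CategoryStruct.comp ι (AlgebraicGeometry.Proj.map φ hφ') : H ⟶ (AlgebraicGeometry.Proj (MvPolynomial.homogeneousSubmodule (Fin (n + 1)) O))) → ∃ (P' : AlgebraicGeometry.Scheme.{0}) (σ : P' ⟶ (AlgebraicGeometry.Proj (MvPolynomial.homogeneousSubmodule (Fin (n + 1)) O))) (S' : Set P'), (∀ Q : (∀ X' : AlgebraicGeometry.Scheme.{0}, (X' ⟶ (AlgebraicGeometry.Proj (MvPolynomial.homogeneousSubmodule (Fin (n + 1)) O))) → Set X' → Prop), Q (AlgebraicGeometry.Proj (MvPolynomial.homogeneousSubmodule (Fin (n + 1)) O)) (CategoryTheory.CategoryStruct.id _) Y → (∀ (X' X'' : AlgebraicGeometry.Scheme.{0}) (σ' : X' ⟶ (AlgebraicGeometry.Proj (MvPolynomial.homogeneousSubmodule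 (Fin (n + 1)) O))) (Y' : Set X') (C : X'.IdealSheafData) (τ : X'' ⟶ X'), Q X' σ' Y' → Literature.AlgebraicGeometry.Resolution.IsBlowup τ C → Literature.AlgebraicGeometry.Resolution.Scheme.IsRegular C.subscheme → AlgebraicGeometry.Flat (CategoryTheory.CategoryStruct.comp C.subschemeι (CategoryTheory.CategoryStruct.comp σ' (CategoryTheory.CategoryStruct.comp (AlgebraicGeometry.Proj.toSpecZero (MvPolynomial.homogeneousSubmodule (Fin (n + 1)) O)) (AlgebraicGeometry.Spec.map (CommRingCat.ofHom (algebraMap O (MvPolynomial.homogeneousSubmodule (Fin (n + 1)) O 0))))))) → σ' '' (C.support : Set X') ⊆ {x | ¬ IsGenericPoint x Y} → (C.support : Set X') ∩ (CategoryTheory.CategoryStruct.comp σ' (CategoryTheory.CategoryStruct.comp (AlgebraicGeometry.Proj.toSpecZero (MvPolynomial.homogeneousSubmodule (Fin (n + 1)) O)) (AlgebraicGeometry.Spec.map (CommRingCat.ofHom (algebraMap O (MvPolynomial.homogeneousSubmodule (Fin (n + 1)) O 0)))))) ⁻¹' {IsLocalRing.closedPoint O} ⊆ Y' → Q X'' (CategoryTheory.CategoryStruct.comp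 τ σ') (closure (τ ⁻¹' (Y' \ (C.support : Set X'))))) → Q P' σ S') ∧ Literature.AlgebraicGeometry.Resolution.Scheme.IsRegular (AlgebraicGeometry.Scheme.IdealSheafData.vanishingIdeal (⟨closure S', isClosed_closure⟩ : TopologicalSpace.Closeds P')).subscheme) := by
  classical
  intro hp k _ _ _ n H ι hι hH hloc hnose
  letI := MvPolynomial.gradedAlgebra (σ := Fin (n + 1)) (R := k)
  obtain ⟨Z, hZ, hcls, hsub, hnsub, hinf, ⟨e⟩, F₂, υ, hυ, F', γ', T', E', K', hcl, hreg⟩ := hnose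
  obtain ⟨O, i1, i2, i3, i4, i5, i6, π, hπ⟩ := stub_wittRing p hp k
  letI := MvPolynomial.gradedAlgebra (σ := Fin (n + 1)) (R := O)
  obtain ⟨C, hCsm, hKEY⟩ := lift_of_isLiftableNoseClass₂ k n hcls hZ O π hπ
  refine ⟨O, i1, i2, i3, i4, π, hπ, ?_⟩
  intro φ hφ' hφ Y hY
  have hK := hKEY φ hφ' hφ
  have hS : ((C.comap (Proj.map φ hφ')).support : Set (Proj (homogeneousSubmodule (Fin (n + 1)) k))) = Z := by
    rw [hK]; erw [AlgebraicGeometry.Scheme.IdealSheafData.coe_support_vanishingIdeal]; rfl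
  subst hS
  refine hEngine O k π hπ n H ι hι hH φ hφ' hφ C hCsm hnsub hsub hZ hinf ⟨e⟩ ⟨F₂, υ, ?_, F', γ', T', E', K', hcl, hreg⟩ Y hY
  rw [hK]; exact hυ

end Summit.ResolutionOfSingularities.ResolutionOfSingularities.Cruxes.EquisingularLiftNat.Sections

end
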